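import Literature.Algebra.Lie.KatzRecognitionAddenda
import Literature.Algebra.Lie.SymplecticBireflectionPairing
import Literature.Algebra.Lie.SymplecticTransvectionDirectionRecognition
import Literature.Algebra.Lie.SymplecticGabberDiagonal
import Literature.Algebra.Lie.IrreducibleSkewAdjointSemisimple
import Literature.Algebra.Lie.TraceFormFaithful
import Literature.Algebra.Lie.TensorBranchRankObstruction
import Literature.LinearAlgebra.Alternating.DarbouxBasis
import HarnessLib

/-!
# Lemma BL at the Lie level (crux K1Q, route Q8SymplecticPowers): an irreducible `𝔤 ≤ 𝔰𝔭(M, ω)` normalised by an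
# `(i, −i)`-bireflection is `𝔰𝔭(M, ω)` — assembled over Katz's recognition theorems (Thm 1.4, Thm 1.5, Rmk 1.4.1)

`K` algebraically closed of characteristic `0`; `(M, ω)` symplectic, `dim M ≥ 6`, `dim M ≠ 7`; a bireflection datum
`(v₊, v₋, γ)` (`γ v₊ = i v₊`, `γ v₋ = −i v₋`, `γ = 1` on `U = ⟨v₊, v₋⟩^⊥`, `γ` an `ω`-isometry); `L ≤ 𝔰𝔭(M, ω)` a Lie subalgebra,
`Ad γ`-stable, acting irreducibly. CONCLUSION `L = 𝔰𝔭(M, ω)` (**`eq_skewAdjoint_of_bireflection`**), GIVEN ONLY the named facts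
`Katz1990_thm14_gabber_of_ne`, `Katz1990_thm14_gabber_dim8`, `Katz1990_thm15_pseudoreflection`, `Katz1990_rmk141_nonsimple`
([Katz, ESDE, Ch. 1, p. 10], tree files `KatzRecognitionTheorems` ∕ `KatzRecognitionAddenda`). No simplicity hypothesis, no
separate `dim M = 8` count.

Chain (all bricks in the tree): `L` is semisimple (`IrreducibleSkewAdjoint.hasTrivialRadical_of_irreducible_of_le_skewAdjoint`);
(G2) `L` has a non-zero `±i`-eigen-operator, (G3) it is a root `s_{u v₊}` (`SymplecticBireflectionGrading`); the trace form
(`traceForm_nondegenerate_of_lieSubalgebra_end`) pairs it with a root `s_{w v₋}`, `ω(u, w) ≠ 0`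
(`SymplecticBireflection.exists_partner_of_symSq_mem`); case (a) two roots `s_{u₁ v₊}, s_{u₂ v₊}` with `ω(u₁, u₂) ≠ 0` bracket
to the transvection direction `s_{v₊ v₊}` and Katz 1.5 concludes (`TransvectionDirection.eq_skewAdjoint_of_symSq_self_mem`);
case (b) the bracket `[s_{u v₊}, s_{w v₋}]` is Gabber's diagonal (`GabberDiagonal.containsDiagonal_of_gabber_mem`) and, for `L`
SIMPLE, Katz 1.4 (or its `n = 8` addendum) with the Schur exclusions (`InvariantForms`) concludes
(`eq_skewAdjoint_of_irreducible_of_bireflection`); for `L` NOT simple, Remark 1.4.1 puts `L = 𝔰𝔩(V₂) ⊗ 1 + 1 ⊗ 𝔥` on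
`M ≃ V₂ ⊗ V′` (`dim V₂ = 2`), and the rank-2 root `s_{u v₊} ∈ L` is excluded from every such algebra by the slice count + parity
brick `TensorObstruction.false_of_skew_of_finrank_range_le_two` (brick (d), whatever `𝔥` is). HONEST FRAME: algebra only;
K1Q ∕ HC are NOT proved here; the `−i` case is reduced to the `i` case by the datum `(v₋, −v₊, −i)`.
-/

set_option linter.dupNamespace false

namespace Summit.HodgeConjecture.HodgeConjecture.Theorems.Q8BireflectionLieDensity

-- Mathlib's own non-instance `def` for the commutator bracket on an associative ring, enabled LOCALLY exactly as
-- `Mathlib.Algebra.Lie.SkewAdjoint` and the Literature bricks do.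
attribute [local instance 100] LieRing.ofAssociativeRing

open Module Literature.Algebra.Lie Literature.Algebra.Lie.KatzRecognition Literature.Algebra.Lie.SymplecticSymmetricSquares
  Literature.Algebra.Lie.SymplecticBireflection Literature.Algebra.Lie.InvariantForms Literature.Algebra.Lie.GabberDiagonal
  Literature.Algebra.Lie.TransvectionDirection Literature.Algebra.Lie.IrreducibleSkewAdjoint
open LinearMap (BilinForm)
open scoped TensorProduct

variable {K : Type} [Field K] [IsAlgClosed K] [CharZero K] {V : Type} [AddCommGroup V] [Module K V] [FiniteDimensional K V]

omit [IsAlgClosed K] [CharZero K] [FiniteDimensional K V] in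
/-- `ContainsDiagonal` transported along an equality of dimensions `n = n'`. -/
theorem containsDiagonal_cast {L : LieSubalgebra K (Module.End K V)} {n n' : ℕ} (h : n = n') {d : Fin n → K}
    (hd : ContainsDiagonal L d) : ContainsDiagonal L (fun i : Fin n' => d (Fin.cast h.symm i)) := by
  subst h
  exact hd

omit [IsAlgClosed K] [CharZero K] [FiniteDimensional K V] in
/-- Skewness read off `L ≤ 𝔰𝔭(ω)`. -/
theorem skew_of_le {ω : BilinForm K V} {L : LieSubalgebra K (Module.End K V)} (hle : L ≤ skewAdjointLieSubalgebra ω) :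
    ∀ X ∈ L, ∀ x y, ω (X x) y = -ω x (X y) := by
  intro X hX x y
  have hX' : X ∈ ω.skewAdjointSubmodule := hle hX
  rw [LinearMap.mem_skewAdjointSubmodule] at hX'
  have := hX' x y
  rwa [Pi.neg_apply, map_neg] at this

omit [IsAlgClosed K] in
/-- The trace form `(X, Y) ↦ tr(X Y)` is non-degenerate on a semisimple `L ≤ End(M)` (tree: `traceForm_nondegenerate_of_lieSubalgebra_end`). -/
theorem trace_mul_separating (L : LieSubalgebra K (Module.End K V)) [LieAlgebra.HasTrivialRadical K L] :
    ∀ X ∈ (L.toSubmodule : Submodule K (Module.End K V)), (∀ Y ∈ (L.toSubmodule : Submodule K (Module.End K V)),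
      LinearMap.trace K V (X * Y) = 0) → X = 0 := by
  intro X hX h
  have hnd := traceForm_nondegenerate_of_lieSubalgebra_end (k := K) (V := V) L
  have h0 : (⟨X, hX⟩ : L) = 0 := by
    refine hnd.1 ⟨X, hX⟩ fun Y => ?_
    rw [LieModule.traceForm_apply_apply]
    have h1 : (LieModule.toEnd K L V ⟨X, hX⟩ : Module.End K V) = X := by ext m; rfl
    have h2 : (LieModule.toEnd K L V Y : Module.End K V) = (Y : Module.End K V) := by ext m; rfl
    rw [← Module.End.mul_eq_comp, h1, h2]
    exact h Y Y.2
  exact congrArg Subtype.val h0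

section Core

variable {ω : BilinForm K V} (hωn : ω.Nondegenerate) (hω : ω.IsAlt) {i : K} (hi : i * i = -1) {vp vm : V} (hpm : ω vp vm = 1)
  {γ : V ≃ₗ[K] V} (hγp : γ vp = i • vp) (hγm : γ vm = (-i) • vm) (hγU : ∀ x, ω x vp = 0 → ω x vm = 0 → γ x = x)
  (hγω : ∀ x y, ω (γ x) (γ y) = ω x y)

include hωn hω hi hpm hγp hγm hγU hγω in
/-- **Core of BL, `i`-case.** With the datum and `L ≤ 𝔰𝔭(ω)` irreducible, `Ad γ`-stable, SIMPLE (used in case (b) only), if `L`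
contains a non-zero `X` with `γ X = i X γ` then `L = 𝔰𝔭(ω)` — given Katz 1.4 (`n ≠ 7, 8` and `n = 8` forms) and Katz 1.5. -/
theorem eq_skewAdjoint_of_I_eigen (h14 : Katz1990_thm14_gabber_of_ne) (h14' : Katz1990_thm14_gabber_dim8)
    (h15 : Katz1990_thm15_pseudoreflection) (L : LieSubalgebra K (Module.End K V)) (hle : L ≤ skewAdjointLieSubalgebra ω)
    (hL : ∀ X ∈ L, γ.conj X ∈ L) (hirr : IsIrreducibleOn L) (hsimple : LieAlgebra.IsSimple K L) (h7 : finrank K V ≠ 7)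
    {X : Module.End K V} (hXL : X ∈ L) (hX0 : X ≠ 0) (hX : ∀ z, γ (X z) = i • X (γ z)) :
    L = skewAdjointLieSubalgebra ω := by
  have h2 : (2 : K) ≠ 0 := two_ne_zero
  have hvp : vp ≠ 0 := by rintro rfl; rw [map_zero, LinearMap.zero_apply] at hpm; exact zero_ne_one hpm
  haveI : Nontrivial V := ⟨⟨vp, 0, hvp⟩⟩
  have hskew := skew_of_le hle
  -- semisimplicity
  haveI : LieAlgebra.HasTrivialRadical K L := hasTrivialRadical_of_irreducible_of_le_skewAdjoint hωn hω L hle hirr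
  haveI : Module.Finite K L := inferInstanceAs (Module.Finite K L.toSubmodule)
  haveI : LieAlgebra.IsSemisimple K L := inferInstance
  -- (G3) the eigen-operator is a root `s_{u v₊}`
  obtain ⟨u, ⟨hup, hum⟩, hXu⟩ := exists_eq_symSq_of_conj_eq_I_smul hω hi h2 hpm hγp hγm hγU (hskew X hXL) hX
  have hXeq : X = symSq ω u vp := by ext z; rw [hXu z, symSq_apply]
  have hu : u ≠ 0 := by rintro rfl; exact hX0 (by rw [hXeq, symSq_zero_left])
  have huL : symSq ω u vp ∈ L := hXeq ▸ hXL
  -- the trace-form partner `s_{w v₋}`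
  obtain ⟨w, ⟨hwp, hwm⟩, hwL, huw⟩ := exists_partner_of_symSq_mem hω hi h2 hpm hγp hγm hγU hγω L.toSubmodule
    (fun X hX => hL X hX) (fun X hX => hskew X hX) (trace_mul_separating L) hup hum hu huL
  by_cases hA : ∃ u₁ u₂ : V, (ω u₁ vp = 0 ∧ ω u₂ vp = 0) ∧ symSq ω u₁ vp ∈ L ∧ symSq ω u₂ vp ∈ L ∧ ω u₁ u₂ ≠ 0
  · -- case (a): a transvection direction `s_{v₊ v₊} ∈ L`, then Katz 1.5
    obtain ⟨u₁, u₂, ⟨hu₁p, hu₂p⟩, hu₁L, hu₂L, h12⟩ := hA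
    have hbr : ⁅symSq ω u₁ vp, symSq ω u₂ vp⁆ = ω u₂ u₁ • symSq ω vp vp := by
      rw [lie_symSq_symSq hω]
      have e1 : ω vp u₁ = 0 := by rw [← LinearMap.IsAlt.neg hω u₁ vp, hu₁p, neg_zero]
      rw [e1, hω vp, hu₂p, zero_smul, zero_smul, zero_smul, zero_add, zero_add, add_zero]
    have h21 : ω u₂ u₁ ≠ 0 := by rw [← LinearMap.IsAlt.neg hω u₁ u₂]; exact neg_ne_zero.2 h12
    have hvL : symSq ω vp vp ∈ L := by
      have := L.smul_mem (ω u₂ u₁)⁻¹ (L.lie_mem hu₁L hu₂L)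
      rwa [hbr, smul_smul, inv_mul_cancel₀ h21, one_smul] at this
    have hpu₁ : ω vp u₁ = 0 := by rw [← LinearMap.IsAlt.neg hω u₁ vp, hu₁p, neg_zero]
    have hpu₂ : ω vp ((ω u₁ u₂)⁻¹ • u₂) = 0 := by
      rw [map_smul, smul_eq_mul, ← LinearMap.IsAlt.neg hω u₂ vp, hu₂p, neg_zero, mul_zero]
    have h12' : ω u₁ ((ω u₁ u₂)⁻¹ • u₂) = 1 := by rw [map_smul, smul_eq_mul, inv_mul_cancel₀ h12]
    exact eq_skewAdjoint_of_symSq_self_mem h15 hωn hω L hle hirr hvp hvL hpm h12' hpu₁ hpu₂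
  · -- case (b): Gabber's diagonal `[s_{u v₊}, s_{w v₋}] ∈ L`, then Katz 1.4 (SIMPLE `L`)
    have hH : gabber ω vp vm u w ∈ L := by
      have := L.lie_mem huL hwL
      rwa [LieRing.of_associative_ring_bracket] at this
    have hcd := containsDiagonal_of_gabber_mem hω hpm hup hum hwp hwm huw L hH
    have hn := GabberDiagonal.finrank_eq (K := K) hω hpm hup hum hwp hwm huw
    set n := 2 + (finrank K (orth ω vp vm u w) + 2) with hndef
    have h4 : 4 ≤ n := by omega
    have hn7 : n ≠ 7 := fun h => h7 (hn.trans h)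
    -- the exclusions, shared by both sub-cases
    have hpu : ω vp u = 0 := by rw [← LinearMap.IsAlt.neg hω u vp, hup, neg_zero]
    have hpw' : ω vp ((ω u w)⁻¹ • w) = 0 := by
      rw [map_smul, smul_eq_mul, ← LinearMap.IsAlt.neg hω w vp, hwp, neg_zero, mul_zero]
    have huw' : ω u ((ω u w)⁻¹ • w) = 1 := by rw [map_smul, smul_eq_mul, inv_mul_cancel₀ huw]
    have notSL : ¬ IsSL L := not_isSL_of_skew hω hskew hpm huw' hpu hpw'
    have notSO : ¬ IsSO L := fun hSO => by
      obtain ⟨B, hB, hBs, hBL⟩ := hSO.exists_forall_skew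
      exact not_symm_invariant_of_le_sp h2 hωn hω hle hirr hB hBs hBL
    have ofSP : IsSP L → L = skewAdjointLieSubalgebra ω := fun hSP => by
      obtain ⟨B, hB, -, hLB⟩ := hSP
      exact eq_skewAdjoint_of_eq_skewAdjoint_of_le hωn hB hle hLB hirr
    by_cases hn8 : n = 8
    · -- `n = 8`: the addendum, fourth disjunct excluded like `IsSO`
      have hcd8 := containsDiagonal_cast hn8 hcd
      have hpat : (fun j : Fin 8 => gabberPattern K n (Fin.cast hn8.symm j)) =
          (fun j : Fin 8 => if (j : ℕ) < 2 then (1 : K) else if 6 ≤ (j : ℕ) then (-1 : K) else 0) := by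
        funext j
        simp only [gabberPattern, Fin.val_cast, hn8]
      rw [hpat] at hcd8
      rcases h14' K V L hsimple hirr hcd8 with hSL | hSO | hSP | ⟨B, hB, hBs, hBL⟩
      · exact absurd hSL notSL
      · exact absurd hSO notSO
      · exact ofSP hSP
      · exact (not_symm_invariant_of_le_sp h2 hωn hω hle hirr hB hBs hBL).elim
    · rcases h14 K V n L h4 hn7 hn8 hsimple hirr hcd with hSL | hSO | hSP
      · exact absurd hSL notSL
      · exact absurd hSO notSO
      · exact ofSP hSP

end Core

/-- **BL at the Lie level (simple case).** `K` algebraically closed, `char K = 0`; `ω` non-degenerate alternating on `M`,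
`3 ≤ dim M ≠ 7`; a bireflection datum `(v₊, v₋, γ, i)` with `γ` an `ω`-isometry; `L ≤ 𝔰𝔭(M, ω)` a Lie subalgebra, stable under
`X ↦ γ X γ⁻¹`, acting irreducibly, and SIMPLE. Given the named facts Katz 1.4 (both forms) and Katz 1.5: `L = 𝔰𝔭(M, ω)`.
(The `−i`-case of (G2) is the `i`-case for the datum `(v₋, −v₊, −i)`.) -/
theorem eq_skewAdjoint_of_irreducible_of_bireflection (h14 : Katz1990_thm14_gabber_of_ne)
    (h14' : Katz1990_thm14_gabber_dim8) (h15 : Katz1990_thm15_pseudoreflection) {ω : BilinForm K V}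
    (hωn : ω.Nondegenerate) (hω : ω.IsAlt) {i : K} (hi : i * i = -1) {vp vm : V} (hpm : ω vp vm = 1) {γ : V ≃ₗ[K] V}
    (hγp : γ vp = i • vp) (hγm : γ vm = (-i) • vm) (hγU : ∀ x, ω x vp = 0 → ω x vm = 0 → γ x = x)
    (hγω : ∀ x y, ω (γ x) (γ y) = ω x y) (L : LieSubalgebra K (Module.End K V)) (hle : L ≤ skewAdjointLieSubalgebra ω)
    (hL : ∀ X ∈ L, γ.conj X ∈ L) (hirr : IsIrreducibleOn L) (hsimple : LieAlgebra.IsSimple K L) (h3 : 3 ≤ finrank K V)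
    (h7 : finrank K V ≠ 7) : L = skewAdjointLieSubalgebra ω := by
  have h2 : (2 : K) ≠ 0 := two_ne_zero
  obtain ⟨X, hXL, hX0, hX | hX⟩ :=
    exists_ne_zero_conj_eq_I_smul_or hω hi h2 hpm hγp hγm hγU L.toSubmodule (fun X hX => hL X hX) hirr h3
  · exact eq_skewAdjoint_of_I_eigen hωn hω hi hpm hγp hγm hγU hγω h14 h14' h15 L hle hL hirr hsimple h7 hXL hX0 hX
  · -- the datum `(v₋, −v₊, −i)`
    have hi' : (-i) * (-i) = -1 := by rw [neg_mul_neg, hi]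
    have hpm' : ω vm (-vp) = 1 := by rw [map_neg, ← LinearMap.IsAlt.neg hω vp vm, hpm, neg_neg]
    have hγp' : γ vm = (-i) • vm := hγm
    have hγm' : γ (-vp) = (-(-i)) • (-vp) := by rw [map_neg, hγp, neg_neg, smul_neg]
    have hγU' : ∀ x, ω x vm = 0 → ω x (-vp) = 0 → γ x = x := fun x h1 h2' => by
      rw [map_neg, neg_eq_zero] at h2'; exact hγU x h2' h1
    exact eq_skewAdjoint_of_I_eigen hωn hω hi' hpm' hγp' hγm' hγU' hγω h14 h14' h15 L hle hL hirr hsimple h7 hXL hX0 hX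

/-! ## The non-simple branch: Remark 1.4.1 + the rank obstruction (brick (d)) -/

omit [IsAlgClosed K] in
/-- Unpacking Katz's Remark 1.4.1 against the rank-2 root: if `L ≤ 𝔰𝔭(ω)` (`dim M ≥ 6`) is the tensor branch
`𝔰𝔩(V₂) ⊗ 1 + 1 ⊗ 𝔥` under some `M ≃ V₂ ⊗ V′`, `dim V₂ = 2`, then `L` has no member `X ≠ 0` of rank `≤ 2`
(`TensorObstruction.false_of_skew_of_finrank_range_le_two`; `𝔥` arbitrary). -/
theorem false_of_tensorBranch_of_rank_le_two {ω : BilinForm K V} (hωn : ω.Nondegenerate) (hω : ω.IsAlt)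
    (L : LieSubalgebra K (Module.End K V)) (hle : L ≤ skewAdjointLieSubalgebra ω) (h6 : 6 ≤ finrank K V)
    {V₂ : Type} [AddCommGroup V₂] [Module K V₂] {V' : Type} [AddCommGroup V'] [Module K V'] (e : V ≃ₗ[K] V₂ ⊗[K] V')
    (H : LieSubalgebra K (Module.End K V')) (hV₂ : finrank K V₂ = 2)
    (hmem : ∀ x : Module.End K V, x ∈ L ↔ ∃ A : Module.End K V₂, LinearMap.trace K V₂ A = 0 ∧ ∃ h ∈ H,
      (e : V →ₗ[K] V₂ ⊗[K] V') ∘ₗ x ∘ₗ (e.symm : V₂ ⊗[K] V' →ₗ[K] V) =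
        TensorProduct.map A LinearMap.id + TensorProduct.map LinearMap.id h)
    {X : Module.End K V} (hXL : X ∈ L) (hX0 : X ≠ 0) (hXr : finrank K (LinearMap.range X) ≤ 2) : False := by
  haveI : FiniteDimensional K V₂ := Module.finite_of_finrank_pos (by rw [hV₂]; norm_num)
  have hdim : finrank K V = 2 * finrank K V' := by rw [e.finrank_eq, Module.finrank_tensorProduct, hV₂]
  have hk : 3 ≤ finrank K V' := by omega
  haveI : FiniteDimensional K V' := Module.finite_of_finrank_pos (by omega)
  have hA : ∀ A : Module.End K V₂, LinearMap.trace K V₂ A = 0 → ∃ x ∈ L.toSubmodule,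
      (e : V →ₗ[K] V₂ ⊗[K] V') ∘ₗ x ∘ₗ (e.symm : V₂ ⊗[K] V' →ₗ[K] V) = TensorProduct.map A LinearMap.id := by
    intro A hA0
    refine ⟨(e.symm : V₂ ⊗[K] V' →ₗ[K] V) ∘ₗ TensorProduct.map A LinearMap.id ∘ₗ (e : V →ₗ[K] V₂ ⊗[K] V'), ?_, ?_⟩
    · have hconj : (e : V →ₗ[K] V₂ ⊗[K] V') ∘ₗ ((e.symm : V₂ ⊗[K] V' →ₗ[K] V) ∘ₗ TensorProduct.map A LinearMap.id ∘ₗ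
          (e : V →ₗ[K] V₂ ⊗[K] V')) ∘ₗ (e.symm : V₂ ⊗[K] V' →ₗ[K] V) = TensorProduct.map A LinearMap.id :=
        LinearMap.ext fun p => by
          simp only [LinearMap.coe_comp, LinearEquiv.coe_coe, Function.comp_apply, LinearEquiv.apply_symm_apply]
      exact (hmem _).2 ⟨A, hA0, 0, H.zero_mem, by rw [TensorProduct.map_zero_right, add_zero]; exact hconj⟩
    · exact LinearMap.ext fun p => by
        simp only [LinearMap.coe_comp, LinearEquiv.coe_coe, Function.comp_apply, LinearEquiv.apply_symm_apply]
  obtain ⟨A, hA0, h, -, hXe⟩ := (hmem X).1 hXL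
  exact TensorObstruction.false_of_skew_of_finrank_range_le_two hωn hω L.toSubmodule (fun x hx => skew_of_le hle x hx) e hV₂
    hk hA hXL hX0 hXr ⟨A, hA0, h, hXe⟩

omit [IsAlgClosed K] [CharZero K] in
/-- The rank of a root `s_{u v}` is at most `2`. -/
theorem finrank_range_symSq_le_two (ω : BilinForm K V) (u v : V) : finrank K (LinearMap.range (symSq ω u v)) ≤ 2 :=
  TensorObstruction.finrank_range_le_two_of_mem_sup (u := v) (v := u) fun z => by
    rw [symSq_apply]
    exact Submodule.add_mem_sup (Submodule.smul_mem _ _ (Submodule.mem_span_singleton_self _))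
      (Submodule.smul_mem _ _ (Submodule.mem_span_singleton_self _))

/-- **Lemma BL at the Lie level.** `K` algebraically closed, `char K = 0`; `ω` non-degenerate alternating on `M`,
`6 ≤ dim M ≠ 7`; a bireflection datum `(v₊, v₋, γ, i)` (`i² = −1`, `ω(v₊, v₋) = 1`, `γ v₊ = i v₊`, `γ v₋ = −i v₋`, `γ = 1` on
`⟨v₊, v₋⟩^⊥`, `γ` an `ω`-isometry); `L ≤ 𝔰𝔭(M, ω)` a Lie subalgebra, stable under `X ↦ γ X γ⁻¹`, acting irreducibly. Given the
named facts Katz Thm 1.4 (both forms), Thm 1.5 and Rmk 1.4.1: `L = 𝔰𝔭(M, ω)`. The simple case is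
`eq_skewAdjoint_of_irreducible_of_bireflection`; in the non-simple case Remark 1.4.1 (even dimension: a symplectic space)
exhibits `L` as a tensor branch, which the rank-2 root `s_{u v±} ∈ L` of (G2)–(G3) rules out
(`false_of_tensorBranch_of_rank_le_two`). Algebra only; K1Q ∕ HC are NOT proved here. -/
theorem eq_skewAdjoint_of_bireflection (h14 : Katz1990_thm14_gabber_of_ne) (h14' : Katz1990_thm14_gabber_dim8)
    (h15 : Katz1990_thm15_pseudoreflection) (h141 : Katz1990_rmk141_nonsimple) {ω : BilinForm K V}
    (hωn : ω.Nondegenerate) (hω : ω.IsAlt) {i : K} (hi : i * i = -1) {vp vm : V} (hpm : ω vp vm = 1) {γ : V ≃ₗ[K] V}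
    (hγp : γ vp = i • vp) (hγm : γ vm = (-i) • vm) (hγU : ∀ x, ω x vp = 0 → ω x vm = 0 → γ x = x)
    (hγω : ∀ x y, ω (γ x) (γ y) = ω x y) (L : LieSubalgebra K (Module.End K V)) (hle : L ≤ skewAdjointLieSubalgebra ω)
    (hL : ∀ X ∈ L, γ.conj X ∈ L) (hirr : IsIrreducibleOn L) (h6 : 6 ≤ finrank K V) (h7 : finrank K V ≠ 7) :
    L = skewAdjointLieSubalgebra ω := by
  have h3 : 3 ≤ finrank K V := by omega
  by_cases hsimple : LieAlgebra.IsSimple K L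
  · exact eq_skewAdjoint_of_irreducible_of_bireflection h14 h14' h15 hωn hω hi hpm hγp hγm hγU hγω L hle hL hirr hsimple h3 h7
  · exfalso
    have h2 : (2 : K) ≠ 0 := two_ne_zero
    have hvp : vp ≠ 0 := by rintro rfl; rw [map_zero, LinearMap.zero_apply] at hpm; exact zero_ne_one hpm
    haveI : Nontrivial V := ⟨⟨vp, 0, hvp⟩⟩
    haveI : LieAlgebra.HasTrivialRadical K L := hasTrivialRadical_of_irreducible_of_le_skewAdjoint hωn hω L hle hirr
    haveI : Module.Finite K L := inferInstanceAs (Module.Finite K L.toSubmodule)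
    haveI : LieAlgebra.IsSemisimple K L := inferInstance
    have hskew := skew_of_le hle
    -- a symplectic space is even-dimensional (Darboux, tree `exists_symplecticBasis_card`)
    have heven : Even (finrank K V) := by
      obtain ⟨ι, _, _, b, hcard, -⟩ := Literature.LinearAlgebra.Alternating.exists_symplecticBasis_card hω hωn
      exact ⟨Fintype.card ι, by omega⟩
    -- (G2)–(G3) in either eigen-branch: a rank-2 root `s_{u v±} ∈ L`, its trace-form partner, Gabber's diagonal, Remark 1.4.1,
    -- and the rank obstruction.
    have key : ∀ {i' : K} (_ : i' * i' = -1) {vp' vm' : V} (_ : ω vp' vm' = 1) (_ : γ vp' = i' • vp')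
        (_ : γ vm' = (-i') • vm') (_ : ∀ x, ω x vp' = 0 → ω x vm' = 0 → γ x = x) {X : Module.End K V} (_ : X ∈ L)
        (_ : X ≠ 0) (_ : ∀ z, γ (X z) = i' • X (γ z)), False := by
      intro i' hi' vp' vm' hpm' hγp' hγm' hγU' X hXL hX0 hX
      obtain ⟨u, ⟨hup, hum⟩, hXu⟩ := exists_eq_symSq_of_conj_eq_I_smul hω hi' h2 hpm' hγp' hγm' hγU' (hskew X hXL) hX
      have hXeq : X = symSq ω u vp' := by ext z; rw [hXu z, symSq_apply]
      have hu : u ≠ 0 := by rintro rfl; exact hX0 (by rw [hXeq, symSq_zero_left])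
      have huL : symSq ω u vp' ∈ L := hXeq ▸ hXL
      obtain ⟨w, ⟨hwp, hwm⟩, hwL, huw⟩ := exists_partner_of_symSq_mem hω hi' h2 hpm' hγp' hγm' hγU' hγω L.toSubmodule
        (fun X hX => hL X hX) (fun X hX => hskew X hX) (trace_mul_separating L) hup hum hu huL
      have hH : gabber ω vp' vm' u w ∈ L := by
        have := L.lie_mem huL hwL
        rwa [LieRing.of_associative_ring_bracket] at this
      have hcd := containsDiagonal_of_gabber_mem hω hpm' hup hum hwp hwm huw L hH
      have hn := GabberDiagonal.finrank_eq (K := K) hω hpm' hup hum hwp hwm huw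
      set n := 2 + (finrank K (orth ω vp' vm' u w) + 2) with hndef
      have h4 : 4 ≤ n := by omega
      have hev : Even n := hn ▸ heven
      obtain ⟨V₂, _, _, V', _, _, e, H, hV₂, -, hmem⟩ :=
        Katz1990_rmk141_nonsimple.of_even h141 n h4 hev L inferInstance hsimple hirr hcd
      have hXr : finrank K (LinearMap.range X) ≤ 2 := by rw [hXeq]; exact finrank_range_symSq_le_two ω u vp'
      exact false_of_tensorBranch_of_rank_le_two hωn hω L hle h6 e H hV₂ hmem hXL hX0 hXr
    obtain ⟨X, hXL, hX0, hX | hX⟩ :=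
      exists_ne_zero_conj_eq_I_smul_or hω hi h2 hpm hγp hγm hγU L.toSubmodule (fun X hX => hL X hX) hirr h3
    · exact key hi hpm hγp hγm hγU hXL hX0 hX
    · have hi' : (-i) * (-i) = -1 := by rw [neg_mul_neg, hi]
      have hpm' : ω vm (-vp) = 1 := by rw [map_neg, ← LinearMap.IsAlt.neg hω vp vm, hpm, neg_neg]
      have hγm' : γ (-vp) = (-(-i)) • (-vp) := by rw [map_neg, hγp, neg_neg, smul_neg]
      have hγU' : ∀ x, ω x vm = 0 → ω x (-vp) = 0 → γ x = x := fun x h1 h2' => by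
        rw [map_neg, neg_eq_zero] at h2'; exact hγU x h2' h1
      exact key hi' hpm' hγm hγm' hγU' hXL hX0 hX

end Summit.HodgeConjecture.HodgeConjecture.Theorems.Q8BireflectionLieDensity
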